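import Summits.QuantumFields.YangMills.Theorems.BalabanUVNodesN07DbarFrameTowerOfReads
import Summits.QuantumFields.YangMills.Theorems.BalabanUVNodesN07NormalisationSymOfRecord
import HarnessLib

/-!
# N07 [B11] (= [15] = [Balaban1985Variational]) Sect. F — plan g93 WORD A3⁵ = ρ3 ∕ director №310 (ii), (c-iii) part 3: **THE φ-LETTER IN CLOSED FORM AND AT THE RECORD** —
# `φ_i := 100·σ_i²`, `σ_i = 120ℓ²Lⁱs₀`, closes (L1″)'s recursion for `L ≥ 13` once `σ_j ≤ 10⁻⁴`; hence, at NODE 00's objects (`avOfRecord F N K`, the averaged contour datum `symCd F N K`,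
# `exp[mean log]`), for every `SU(N)` fine field within `s₀` of `1` under a set of top sites and every family of UST's accumulated double-bar frames:
# `‖V_i(z) − S_i(z)‖ ≤ 100·(120ℓ²Lⁱs₀)²` under the top sites — an ε²-TYPE letter (at the record `Lʲs₀ ≍ κ·ε_j·L`), the `Ψ`-cost of MODULE 93′'s reader

Cell `pub-ymgap`, seat `pub-ymgap-dag-n07-e` g30 (FAN-OUT §N07 row s3; LANE OWNER of the K0 road chart side).  `--kind proof --supports stmt-QuantumFields-20541 --as helper` (K0⁷);
count-neutral; THEOREMS ONLY (0 `def`).  [3] = [Balaban1985Averaging]; [I] = [Balaban1987RG1]; [15] = [Balaban1985Variational].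

WHY.  Part 2 (`…N07DbarFrameTowerOfReads.norm_accFrame_sub_shearRIter_le_of_reads`) leaves the majorant `φ` abstract with (L1″)'s recursion at `p_i = 8σ_i`, `t_i = 12σ_i`.  The recursion is
dominated by the conjugating-frame term `64(t_i + φ_i)²`; with `σ_{i+1} = L·σ_i` and `L ≥ 13` the ansatz `φ_i = 100σ_i²` closes: dividing by `σ_i²`, the step is
`100 + 64(12 + 100σ)² + (1 + 100σ²)(2.16·10⁶·σ²(32 + 300σ)³ + 256σ(24 + 300σ)) ≤ 100·L²`, an increasing polynomial of `σ ≤ 10⁻⁴` bounded by `16900 ≤ 100·13²` (`gcongr` + `norm_num`).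
So the frame mismatch of ⚑ LOCATED-NRM-ROW-CURRENCY, first order for the radial tower, is SECOND order (`100σ_j²`) for the averaged contour datum — the φ-letter of A3⁵.

WHAT IS PROVED (sorry-free; axioms standard).
* §1 ★ `phi_closed_step` (pure real arithmetic: the closed-form step for `13 ≤ L`, `0 ≤ σ ≤ 10⁻⁴`); `phi_closed_small` (`24σ + 300σ² ≤ 1∕24`).
* §2 ★★★ `norm_accFrame_sub_shearRIter_le_closed` (generic `P`, `13 ≤ L`): part 2 with `φ_i := 100σ_i²` — five numeric guards at the top level, NO recursion hypothesis left.
* §3 ★★★ `norm_accFrame_sub_shearRIter_le_record` — the same at NODE 00's objects on the torus `F.P K` of a `T4Family` (`L > 11` odd ⇒ `L ≥ 13`), stated with `avOfRecord F N K` and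
  `symCd F N K` so that it meets MODULE 93′'s `S` by name.
HONEST SCOPE: arithmetic + instantiation; nothing of [15]∕[3]∕[I] analysis asserted beyond parts 1–2 and (L1″); the reads `s₀` of the Landau copy under print's window ((T1)∕(T2)) are the
consumer's (96′); K0⁷ NOT closed; N07 NOT discharged; counts unmoved; one finite 𝕋⁴ programme at fixed ε — the route closes the conditional finite-𝕋⁴ rung `BalabanLadder.UV` ONLY; the YM
mass gap (Clay) is NOT proved by any of this; nothing continuum ∕ ℝ⁴ ∕ OS.  No `def`, no `instance`, no `notation`, no `sorry`.

References: [3] (85) p. 31, (92) p. 31, (97)–(100) p. 32, (110) p. 34, Prop. 4 (134)–(135) p. 38; [I] (0.4)–(0.11) p. 253; [15] (150)–(154) pp. 301–302.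
-/

set_option autoImplicit false

noncomputable section

open scoped BigOperators Matrix.Norms.L2Operator

namespace Summit.QuantumFields.YangMills.BalabanUVNodes.N07DbarFrameTowerClosedForm

open Literature.MathematicalPhysics.QuantumFieldTheory.Balaban1983to89
open Literature.MathematicalPhysics.QuantumFieldTheory.Balaban1983to89.Node00
open T4Continuum (T4Family)
open BlockAveraging ExpMeanLog FederbushMean
open B10Eq27TorusAxialLog (unitsField toUField)
open B5Eq118OneStroke (iterBlockOf)
open Summit.QuantumFields.YangMills.Theorems.Prop8ChartDoubleBar (vframeU dbarIterU)
open Summit.QuantumFields.YangMills.BalabanUVNodes.N07SymContourData (symContourData)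
open Summit.QuantumFields.YangMills.BalabanUVNodes.N07NormalisationSymOfRecord (symCd)
open Summit.QuantumFields.YangMills.BalabanUVNodes.N07DbarFrameTowerOfReads (norm_accFrame_sub_shearRIter_le_of_reads)

/-! ## §1  The closed-form step -/

/-- ★ **THE CLOSED-FORM STEP**: for `13 ≤ L` and `0 ≤ σ ≤ 10⁻⁴`, (L1″)'s recursion at `p = 8σ`, `t = 12σ`, `φ = 100σ²` is closed by `φ′ = 100(Lσ)²` (the bracket after factoring `σ²`
is an increasing polynomial bounded by `16900 = 100·13²`). [cite: Balaban1985Averaging, (100) p.32, (110) p.34 (bookkeeping)] -/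
theorem phi_closed_step {L x : ℝ} (hL : 13 ≤ L) (hx0 : 0 ≤ x) (hx : x ≤ 1 / 10000) :
    100 * x ^ 2 + 64 * (12 * x + 100 * x ^ 2) ^ 2 +
        (1 + 100 * x ^ 2) * (270000 * (8 * x) * (8 * x + (2 * (12 * x) + 3 * (100 * x ^ 2))) ^ 3 +
          4 * (8 * x) ^ 2 * (2 * (12 * x) + 3 * (100 * x ^ 2))) ≤ 100 * (L * x) ^ 2 := by
  have hQ : 100 + 64 * (12 + 100 * x) ^ 2 + (1 + 100 * x ^ 2) * (270000 * 8 * (32 + 300 * x) ^ 3 * x ^ 2 + 256 * x * (24 + 300 * x)) ≤ 16900 := by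
    have h1 : 100 + 64 * (12 + 100 * x) ^ 2 + (1 + 100 * x ^ 2) * (270000 * 8 * (32 + 300 * x) ^ 3 * x ^ 2 + 256 * x * (24 + 300 * x)) ≤
        100 + 64 * (12 + 100 * (1 / 10000 : ℝ)) ^ 2 +
          (1 + 100 * (1 / 10000 : ℝ) ^ 2) * (270000 * 8 * (32 + 300 * (1 / 10000 : ℝ)) ^ 3 * (1 / 10000 : ℝ) ^ 2 + 256 * (1 / 10000 : ℝ) * (24 + 300 * (1 / 10000 : ℝ))) := by
      gcongr
    refine h1.trans ?_
    norm_num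
  have hid : 100 * x ^ 2 + 64 * (12 * x + 100 * x ^ 2) ^ 2 +
        (1 + 100 * x ^ 2) * (270000 * (8 * x) * (8 * x + (2 * (12 * x) + 3 * (100 * x ^ 2))) ^ 3 +
          4 * (8 * x) ^ 2 * (2 * (12 * x) + 3 * (100 * x ^ 2))) =
      x ^ 2 * (100 + 64 * (12 + 100 * x) ^ 2 + (1 + 100 * x ^ 2) * (270000 * 8 * (32 + 300 * x) ^ 3 * x ^ 2 + 256 * x * (24 + 300 * x))) := by ring
  rw [hid]
  have hL2 : (169 : ℝ) ≤ L ^ 2 := by nlinarith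
  calc x ^ 2 * (100 + 64 * (12 + 100 * x) ^ 2 + (1 + 100 * x ^ 2) * (270000 * 8 * (32 + 300 * x) ^ 3 * x ^ 2 + 256 * x * (24 + 300 * x)))
      ≤ x ^ 2 * 16900 := mul_le_mul_of_nonneg_left hQ (sq_nonneg x)
    _ ≤ 100 * (L * x) ^ 2 := by nlinarith [sq_nonneg x, mul_nonneg (sq_nonneg x) (sub_nonneg.mpr hL2)]

/-- The smallness side condition of (L1″) at the closed form: `2·(12σ) + 3·(100σ²) ≤ 1∕24` for `0 ≤ σ ≤ 10⁻⁴`. [cite: Balaban1985Averaging, (110) p.34 (bookkeeping)] -/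
theorem phi_closed_small {x : ℝ} (hx0 : 0 ≤ x) (hx : x ≤ 1 / 10000) : 2 * (12 * x) + 3 * (100 * x ^ 2) ≤ 1 / 24 := by
  nlinarith

/-! ## §2  (L1″) from the reads, closed form -/

variable {P : Params} {N : ℕ} [NeZero N]

/-- ★★★ **THE (L1″) FRAME BRIDGE FROM FLAT READS, CLOSED FORM** (generic `P`, `13 ≤ L`): part 2's `norm_accFrame_sub_shearRIter_le_of_reads` with `φ_i := 100·(120ℓ²Lⁱs₀)²`; displayed: the reads
`‖U(b) − 1‖ ≤ s₀` under `T` and five numeric guards at the top level (`8·3800·ℓ²·Lʲ·s₀ ≤ 1`, `30ℓ²Lʲs₀ < δ_N`, `24σ_j < δ_F`, `12σ_j < δ_N`, `σ_j ≤ 10⁻⁴`).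
[cite: Balaban1985Averaging, (85) p.31, (92) p.31, (97)–(100) p.32, (110) p.34, Prop. 4 (134)–(135) p.38; Balaban1987RG1, (0.4)–(0.11) p.253] -/
theorem norm_accFrame_sub_shearRIter_le_closed (hL13 : 13 ≤ P.L) {j : ℕ} (hj : j ≤ P.m + P.K) (T : Set (Site P j)) (U : GaugeField P 0 (SU N))
    {s₀ : ℝ} (hs₀ : 0 ≤ s₀)
    (hbudget : 8 * 3800 * (((P.d + 2) * P.L : ℕ) : ℝ) ^ 2 * (P.L : ℝ) ^ j * s₀ ≤ 1)
    (hguard : 30 * (((P.d + 2) * P.L : ℕ) : ℝ) ^ 2 * (P.L : ℝ) ^ j * s₀ < deltaSU (Fin N))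
    (hσF : 24 * (120 * (((P.d + 2) * P.L : ℕ) : ℝ) ^ 2 * (P.L : ℝ) ^ j * s₀) < (federbushSU (n := Fin N)).δ)
    (hσS : 12 * (120 * (((P.d + 2) * P.L : ℕ) : ℝ) ^ 2 * (P.L : ℝ) ^ j * s₀) < deltaSU (Fin N))
    (hσ4 : 120 * (((P.d + 2) * P.L : ℕ) : ℝ) ^ 2 * (P.L : ℝ) ^ j * s₀ ≤ 1 / 10000)
    (hU : ∀ b : PBond P 0, iterBlockOf j b.src ∈ T → iterBlockOf j b.tgt ∈ T → ‖((U b : SU N) : Matrix (Fin N) (Fin N) ℂ) - 1‖ ≤ s₀)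
    (V : (i : ℕ) → Site P i → (Matrix (Fin N) (Fin N) ℂ)ˣ) (hV0 : ∀ x, V 0 x = 1)
    (hVs : ∀ (i : ℕ) (y : Site P (i + 1)), V (i + 1) y = V i (emb y) * vframeU (dbarIterU i (unitsField (toUField U))) y) :
    ∀ i, i ≤ j → ∀ z : Site P i, (∀ x : Site P 0, iterBlockOf i x = z → iterBlockOf j x ∈ T) →
      ‖((V i z : (Matrix (Fin N) (Fin N) ℂ)ˣ) : Matrix (Fin N) (Fin N) ℂ) -
        ((shearRIter (fun _ => blockAvg expMeanLogSU) (fun _ => symContourData (federbushSU (n := Fin N))) (loopAvgBlockOp expMeanLogSU) U i z : SU N) : Matrix (Fin N) (Fin N) ℂ)‖ ≤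
        100 * (120 * (((P.d + 2) * P.L : ℕ) : ℝ) ^ 2 * (P.L : ℝ) ^ i * s₀) ^ 2 := by
  have hL1 : (1 : ℝ) ≤ P.L := by exact_mod_cast P.L_pos
  have hL13' : (13 : ℝ) ≤ P.L := by exact_mod_cast hL13
  have hσ0 : ∀ i, 0 ≤ 120 * (((P.d + 2) * P.L : ℕ) : ℝ) ^ 2 * (P.L : ℝ) ^ i * s₀ := fun i => by positivity
  have hσle : ∀ i, i ≤ j → 120 * (((P.d + 2) * P.L : ℕ) : ℝ) ^ 2 * (P.L : ℝ) ^ i * s₀ ≤ 1 / 10000 := fun i hi => by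
    have hpow : (P.L : ℝ) ^ i ≤ (P.L : ℝ) ^ j := pow_le_pow_right₀ hL1 hi
    exact (mul_le_mul_of_nonneg_right (mul_le_mul_of_nonneg_left hpow (by positivity)) hs₀).trans hσ4
  refine norm_accFrame_sub_shearRIter_le_of_reads hL13 hj T U hs₀ hbudget hguard hσF hσS hU V hV0 hVs
    (fun i => 100 * (120 * (((P.d + 2) * P.L : ℕ) : ℝ) ^ 2 * (P.L : ℝ) ^ i * s₀) ^ 2) (by positivity) (fun i hi => ?_) (fun i hi => phi_closed_small (hσ0 i) (hσle i hi.le))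
  have hsucc : 120 * (((P.d + 2) * P.L : ℕ) : ℝ) ^ 2 * (P.L : ℝ) ^ (i + 1) * s₀ = (P.L : ℝ) * (120 * (((P.d + 2) * P.L : ℕ) : ℝ) ^ 2 * (P.L : ℝ) ^ i * s₀) := by
    rw [pow_succ]; ring
  rw [hsucc]
  exact phi_closed_step hL13' (hσ0 i) (hσle i hi.le)

/-! ## §3  At NODE 00's objects -/

section Record

variable (F : T4Family)

/-- `L ≥ 13` on every torus of a `T4Family` (`L` odd and `> 11`). [cite: Balaban1987RG1, (0.1) p.251] -/
theorem thirteen_le_P_L (K : ℕ) : 13 ≤ (F.P K).L := by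
  rw [T4Family.P_L]
  have h11 := F.hL11
  obtain ⟨k, hk⟩ := F.hL.1
  omega

/-- ★★★ **THE φ-LETTER OF A3⁵ AT NODE 00's OBJECTS**: on the torus `F.P K`, for an `SU(N)` fine field `U` within `s₀` of `1` on the fine bonds under a set `T` of level-`j` sites (`j ≤ m+K`)
and EVERY family `V` of UST's accumulated double-bar frames of `U♮`: `‖V_i(z) − S_i(U)(z)‖ ≤ 100·(120ℓ²Lⁱs₀)²` at every level-`i` site under `T`, `i ≤ j`, where
`S = shearRIter (avOfRecord F N K) (symCd F N K) (loopAvgBlockOp expMeanLogSU) U` is print's sheared frame for the averaged contour datum — MODULE 93′'s `S`; five numeric guards displayed.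
[cite: Balaban1985Averaging, (85) p.31, (92) p.31, (97)–(100) p.32, (110) p.34; Balaban1987RG1, (0.4)–(0.11) p.253; Balaban1985Variational, (150)–(154) pp.301–302] -/
theorem norm_accFrame_sub_shearRIter_le_record {N : ℕ} [NeZero N] (K : ℕ) {j : ℕ} (hj : j ≤ (F.P K).m + (F.P K).K) (T : Set (Site (F.P K) j))
    (U : GaugeField (F.P K) 0 (SU N)) {s₀ : ℝ} (hs₀ : 0 ≤ s₀)
    (hbudget : 8 * 3800 * ((((F.P K).d + 2) * (F.P K).L : ℕ) : ℝ) ^ 2 * ((F.P K).L : ℝ) ^ j * s₀ ≤ 1)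
    (hguard : 30 * ((((F.P K).d + 2) * (F.P K).L : ℕ) : ℝ) ^ 2 * ((F.P K).L : ℝ) ^ j * s₀ < deltaSU (Fin N))
    (hσF : 24 * (120 * ((((F.P K).d + 2) * (F.P K).L : ℕ) : ℝ) ^ 2 * ((F.P K).L : ℝ) ^ j * s₀) < (federbushSU (n := Fin N)).δ)
    (hσS : 12 * (120 * ((((F.P K).d + 2) * (F.P K).L : ℕ) : ℝ) ^ 2 * ((F.P K).L : ℝ) ^ j * s₀) < deltaSU (Fin N))
    (hσ4 : 120 * ((((F.P K).d + 2) * (F.P K).L : ℕ) : ℝ) ^ 2 * ((F.P K).L : ℝ) ^ j * s₀ ≤ 1 / 10000)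
    (hU : ∀ b : PBond (F.P K) 0, iterBlockOf j b.src ∈ T → iterBlockOf j b.tgt ∈ T → ‖((U b : SU N) : Matrix (Fin N) (Fin N) ℂ) - 1‖ ≤ s₀)
    (V : (i : ℕ) → Site (F.P K) i → (Matrix (Fin N) (Fin N) ℂ)ˣ) (hV0 : ∀ x, V 0 x = 1)
    (hVs : ∀ (i : ℕ) (y : Site (F.P K) (i + 1)), V (i + 1) y = V i (emb y) * vframeU (dbarIterU i (unitsField (toUField U))) y) :
    ∀ i, i ≤ j → ∀ z : Site (F.P K) i, (∀ x : Site (F.P K) 0, iterBlockOf i x = z → iterBlockOf j x ∈ T) →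
      ‖((V i z : (Matrix (Fin N) (Fin N) ℂ)ˣ) : Matrix (Fin N) (Fin N) ℂ) -
        ((shearRIter (avOfRecord F N K) (fun i => symCd F N K i) (loopAvgBlockOp expMeanLogSU) U i z : SU N) : Matrix (Fin N) (Fin N) ℂ)‖ ≤
        100 * (120 * ((((F.P K).d + 2) * (F.P K).L : ℕ) : ℝ) ^ 2 * ((F.P K).L : ℝ) ^ i * s₀) ^ 2 :=
  norm_accFrame_sub_shearRIter_le_closed (thirteen_le_P_L F K) hj T U hs₀ hbudget hguard hσF hσS hσ4 hU V hV0 hVs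

end Record

end Summit.QuantumFields.YangMills.BalabanUVNodes.N07DbarFrameTowerClosedForm

end
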